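import Literature.Geometry.Lorentzian.KerrSchild

/-!
# Route EIHFluxBalance — `InertialRecession` (E′), K1 / stub `stub_coerMomKernel` (Bk), far field, part F6:
# the matrix form of an `η`-skew generator

Helper file for the crux `stmt-FinalStateConjecture-17403` (glue between Bk's hypothesis "`A` is `η`-skew" and the
hypothesis `hA` of the row tables `…SlavingFarFieldRows*`): an `η`-skew `A` acts by
`A u = (b·ũ, b₁u⁰ − ω₃u² + ω₂u³, b₂u⁰ + ω₃u¹ − ω₁u³, b₃u⁰ − ω₂u¹ + ω₁u²)` with boost part `bᵢ = (A e₀)ⁱ` and rotation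
part `ω₁ = (A e₂)³`, `ω₂ = (A e₃)¹`, `ω₃ = (A e₁)²` (`skew_matrix_form`); in particular `A e₀ = (0, b)` and
`A e₃ = (b₃, ω₂, −ω₁, 0)`. No definitions, no `sorry`. [folklore]
-/

set_option linter.dupNamespace false

noncomputable section

open Literature.Geometry.Lorentzian

namespace Summit.FinalStateConjecture.FinalStateConjecture.Theorems.SublinearIsFree.Slaving

/-- **Matrix form of an `η`-skew generator** (`so(1,3)`: symmetric time–space block `b`, antisymmetric space block `ω`).
[folklore] -/
theorem skew_matrix_form {A : E4 →L[ℝ] E4}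
    (hA : ∀ u w : E4, Minkowski.bilin (A u) w + Minkowski.bilin u (A w) = 0) (u : E4) :
    A u = ![A (E4.basisVector 0) 1 * u 1 + A (E4.basisVector 0) 2 * u 2 + A (E4.basisVector 0) 3 * u 3,
      A (E4.basisVector 0) 1 * u 0 - A (E4.basisVector 1) 2 * u 2 + A (E4.basisVector 3) 1 * u 3,
      A (E4.basisVector 0) 2 * u 0 + A (E4.basisVector 1) 2 * u 1 - A (E4.basisVector 2) 3 * u 3,
      A (E4.basisVector 0) 3 * u 0 - A (E4.basisVector 3) 1 * u 1 + A (E4.basisVector 2) 3 * u 2] := by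
  have hc : ∀ u w : E4, -(A u 0 * w 0) + (A u 1 * w 1 + A u 2 * w 2 + A u 3 * w 3)
      + (-(u 0 * A w 0) + (u 1 * A w 1 + u 2 * A w 2 + u 3 * A w 3)) = 0 := fun u w ↦ by
    simpa [Minkowski.bilin_apply, Fin.sum_univ_three] using hA u w
  -- diagonal entries vanish
  have h00 : A (E4.basisVector 0) 0 = 0 := by have h := hc (E4.basisVector 0) (E4.basisVector 0); simp at h; linarith
  have h11 : A (E4.basisVector 1) 1 = 0 := by have h := hc (E4.basisVector 1) (E4.basisVector 1); simp at h; linarith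
  have h22 : A (E4.basisVector 2) 2 = 0 := by have h := hc (E4.basisVector 2) (E4.basisVector 2); simp at h; linarith
  have h33 : A (E4.basisVector 3) 3 = 0 := by have h := hc (E4.basisVector 3) (E4.basisVector 3); simp at h; linarith
  -- time–space block is symmetric
  have h10 : A (E4.basisVector 1) 0 = A (E4.basisVector 0) 1 := by
    have h := hc (E4.basisVector 0) (E4.basisVector 1); simp at h; linarith
  have h20 : A (E4.basisVector 2) 0 = A (E4.basisVector 0) 2 := by
    have h := hc (E4.basisVector 0) (E4.basisVector 2); simp at h; linarith
  have h30 : A (E4.basisVector 3) 0 = A (E4.basisVector 0) 3 := by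
    have h := hc (E4.basisVector 0) (E4.basisVector 3); simp at h; linarith
  -- space block is antisymmetric
  have h21 : A (E4.basisVector 2) 1 = -A (E4.basisVector 1) 2 := by
    have h := hc (E4.basisVector 1) (E4.basisVector 2); simp at h; linarith
  have h13 : A (E4.basisVector 1) 3 = -A (E4.basisVector 3) 1 := by
    have h := hc (E4.basisVector 3) (E4.basisVector 1); simp at h; linarith
  have h32 : A (E4.basisVector 3) 2 = -A (E4.basisVector 2) 3 := by
    have h := hc (E4.basisVector 2) (E4.basisVector 3); simp at h; linarith
  have hu : u = u 0 • E4.basisVector 0 + u 1 • E4.basisVector 1 + u 2 • E4.basisVector 2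
      + u 3 • E4.basisVector 3 := by
    ext i; fin_cases i <;> simp
  conv_lhs => rw [hu]
  simp only [map_add, map_smul]
  ext i
  fin_cases i <;> simp [h00, h11, h22, h33, h10, h20, h30, h21, h13, h32] <;> ring

/-- The value on the time axis: `A e₀ = (0, b₁, b₂, b₃)`; so `b = 0 ↔ A e₀ = 0`. [folklore] -/
theorem skew_apply_basisVector_zero {A : E4 →L[ℝ] E4}
    (hA : ∀ u w : E4, Minkowski.bilin (A u) w + Minkowski.bilin u (A w) = 0) :
    A (E4.basisVector 0) = ![(0 : ℝ), A (E4.basisVector 0) 1, A (E4.basisVector 0) 2, A (E4.basisVector 0) 3] := by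
  rw [skew_matrix_form hA (E4.basisVector 0)]
  funext i; fin_cases i <;> simp

/-- The value on the spin axis: `A e₃ = (b₃, ω₂, −ω₁, 0)`; so, given `b₃ = 0`, `A e₃ = 0 ↔ ω₁ = ω₂ = 0`. [folklore] -/
theorem skew_apply_basisVector_three {A : E4 →L[ℝ] E4}
    (hA : ∀ u w : E4, Minkowski.bilin (A u) w + Minkowski.bilin u (A w) = 0) :
    A (E4.basisVector 3) = ![A (E4.basisVector 0) 3, A (E4.basisVector 3) 1, -A (E4.basisVector 2) 3, 0] := by
  conv_lhs => rw [skew_matrix_form hA (E4.basisVector 3)]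
  funext i; fin_cases i <;> simp

/-- Registered carrier `slaving_farFieldSkew_slaving12` of the crux item (= `skew_apply_basisVector_zero`). [folklore] -/
theorem slaving_farFieldSkew_slaving12 : open Literature.Geometry.Lorentzian in ∀ {A : E4 →L[ℝ] E4}, (∀ u w : E4, Minkowski.bilin (A u) w + Minkowski.bilin u (A w) = 0) → A (E4.basisVector 0) = ![(0 : ℝ), A (E4.basisVector 0) 1, A (E4.basisVector 0) 2, A (E4.basisVector 0) 3] :=
  skew_apply_basisVector_zero

end Summit.FinalStateConjecture.FinalStateConjecture.Theorems.SublinearIsFree.Slaving
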